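import Summits.NavierStokesRegularity.FluidComputer.RiccatiSliceGenTools
import HarnessLib

/-!
# Fluid computer — support: the `4^{sj}`-weighted block balance of ONE SLICE, `3/2 < s < 5/2`
# (the Riccati integrand `y' ≲ ν^{−(5−2s)/(2s−1)} y^{(2s+1)/(2s−1)}` of Cheskidov–Zaya's Remark 2.3)

HONEST FRAMING (cell `pub-fluidc`, verbatim): *low prior, high value-of-information experiment on Tao's
machine paradigm; NOT a claim that NS blows up.* Support file (successor of `RiccatiSlice`, the case `s = 3/2`).
For ONE smooth, divergence-free, finite-energy field `w` on `ℝ³`, `a_l = ‖Δ̇_l w‖₂`, and a weight `κ = 2s`, `3 < κ < 5`: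
`weighted_slice_le_gen` (**THE RICCATI INTEGRAND AT WEIGHT `κ`**) — one `K = K_κ > 0` with
`∑_{|j|≤L} 2^{κj} (−ν S_j(w) − N_j(w)) ≤ ν/(3C_r²+1)·2^{−L} R + K · ν^{−(5−κ)/(κ−1)} · y_κ(w)^{(κ+1)/(κ−1)}`,
`y_κ = ∑_j 2^{κj} a_j²`, `R = (C_r⁴C₂S₄)² + (C₂E₀)²` on windows where `∑_i T₃(∂_i w) ≤ S₄`, `‖w‖₂ ≤ E₀` (reverse
Bernstein, the pointwise transfer ceiling, `riccati_summation_gen`, Hölder over the levels, Young, and the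
fourth-order tails of `RiccatiSliceGenTools`). 0 sorry; no definitions; no named facts.

## References

* A. Cheskidov, K. Zaya, J. Math. Phys. 57 (2016) 023101 = arXiv:1503.01784, Remark 2.3 (p. 6). [CheskidovZaya2016]
* A. Cheskidov, M. Dai, arXiv:1507.06611, §3.1 (3.6). [CheskidovDai2015]
-/

noncomputable section

open MeasureTheory Set Function Filter Topology
open scoped ENNReal NNReal RealInnerProductSpace
open Literature.Analysis.FluidPDE Literature.Analysis.FunctionSpaces
open Literature.Analysis.FluidPDE.LPBounds (thirdSum)
open Summit.NavierStokesRegularity.FluidComputer.RiccatiSummationGen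
open Summit.NavierStokesRegularity.FluidComputer.RiccatiSlice
open Summit.NavierStokesRegularity.FluidComputer.RiccatiSliceGenTools
open Summit.NavierStokesRegularity.FluidComputer.BlockEnergyIdentity
open Summit.NavierStokesRegularity.FluidComputer.BlockAmplitudeCeiling

namespace Summit.NavierStokesRegularity.FluidComputer.RiccatiSliceGen

/-! ## The Riccati integrand at weight `κ = 2s`, `3 < κ < 5` -/

/-- **THE RICCATI INTEGRAND AT WEIGHT `κ` (Cheskidov–Zaya 2016, Remark 2.3, one time slice; `3 < κ < 5`, i.e.
`3/2 < s < 5/2`).** There is `K = K_κ > 0` such that for every `ν > 0`, every smooth divergence-free `L²` field `w` on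
`ℝ³` with `∑_i T₃(∂_i w) ≤ S₄` and `‖w‖₂ ≤ E₀`, and every `L`:
`∑_{|j|≤L} 2^{κj} (−ν S_j(w) − N_j(w)) ≤ ν/(3C_r²+1) · 2^{−L}((C_r⁴C₂S₄)² + (C₂E₀)²)
  + K · ν^{−(5−κ)/(κ−1)} · (∑_j 2^{κj} ‖Δ̇_j w‖₂²)^{(κ+1)/(κ−1)}`.
Route: reverse Bernstein makes the viscous part `≤ −ν/(3C_r²+1)·D_{κ,L}` (`D_κ = ∑ 2^{(κ+2)j}a_j²`); the pointwise ceiling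
and `riccati_summation_gen` bound the nonlinear part by `A C_κ C_B · y · D₅^{1/2}`; Hölder over the levels
(`tsum_five_le_rpow_mul_rpow`) gives `D₅^{1/2} ≤ y^{(κ−3)/4} D_κ^{(5−κ)/4}`; Young with exponents `4/(κ−1)`, `4/(5−κ)`
(`young_rpow`) splits into `ν/(3C_r²+1)·D_κ + K ν^{−(5−κ)/(κ−1)} y^{(κ+1)/(κ−1)}`; and `D_κ − D_{κ,L} ≤ 2^{−L}(…)`
uniformly (`tsum_weighted_sq_le_window_add'`, `κ + 2 < 7`). At `κ = 3` compare `RiccatiSlice.weighted_slice_le`.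
[cite: CheskidovZaya2016, Remark 2.3 (p. 6)] [cite: CheskidovDai2015, §3.1 (3.6)] -/
theorem weighted_slice_le_gen {κ : ℝ} (hκ3 : 3 < κ) (hκ5 : κ < 5) :
    ∃ K₁ : ℝ, 0 < K₁ ∧ ∀ (ν : ℝ), 0 < ν →
      ∀ (w : EuclideanSpace ℝ (Fin 3) → EuclideanSpace ℝ (Fin 3)), IsSmoothL2Field w → VectorCalculus.IsDivFree w →
      ∀ (S₄ E₀ : ℝ≥0),
        ∑ i, thirdSum (fun x => fderiv ℝ w x (stdOrthonormalBasis ℝ (EuclideanSpace ℝ (Fin 3)) i)) ≤ S₄ →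
        eLpNorm w 2 volume ≤ E₀ → ∀ L : ℕ,
        ∑ j ∈ Finset.Icc (-(L : ℤ)) L, ((2 : ℝ≥0∞) ^ (κ * (j : ℝ))).toReal *
            (-ν * (∑ i, ∫ x, ‖fderiv ℝ (blockFn j w) x (stdOrthonormalBasis ℝ (EuclideanSpace ℝ (Fin 3)) i)‖ ^ 2) -
              ∫ x, ⟪blockFn j w x, blockFn j (convect w w) x⟫) ≤
          ν / (3 * ((lpBounds (Fin 3)).Cr : ℝ) ^ 2 + 1) *
              ((2⁻¹ : ℝ≥0∞) ^ L * ((((lpBounds (Fin 3)).Cr : ℝ≥0∞) ^ 4 * (lpBounds (Fin 3)).C₂ * S₄) ^ 2 +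
                ((lpBounds (Fin 3)).C₂ * E₀) ^ 2)).toReal +
            K₁ * ν ^ (-((5 - κ) / (κ - 1))) *
              ((∑' j : ℤ, (2 : ℝ≥0∞) ^ (κ * (j : ℝ)) * blockL2 w j ^ 2).toReal) ^ ((κ + 1) / (κ - 1)) := by
  set K := lpBounds (Fin 3) with hK
  obtain ⟨A, hAtop, hA⟩ := exists_enorm_transfer_le_local
  obtain ⟨CB, -, hB⟩ := exists_blockSup_le_blockL2
  obtain ⟨C, hCtop, hric⟩ := riccati_summation_gen (κ := κ) (by linarith) hκ5
  set A' : ℝ := (A * C * CB).toReal with hA'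
  -- exponents
  set θ : ℝ := (κ - 3) / 2 with hθ
  set α : ℝ := (5 - κ) / 2 with hα
  set P : ℝ := 2 / (2 - α) with hP
  set β : ℝ := (5 - κ) / (κ - 1) with hβ
  have hθ0 : 0 < θ := by rw [hθ]; linarith
  have hα0 : 0 < α := by rw [hα]; linarith
  have hα2 : α < 2 := by rw [hα]; linarith
  have hκ1 : 0 < κ - 1 := by linarith
  have h2α : 2 - α = (κ - 1) / 2 := by rw [hα]; ring
  have hβe : α / (2 - α) = β := by
    rw [h2α, hα, hβ, div_div_div_cancel_right₀ two_ne_zero]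
  have hpe : (1 + θ / 2) * P = (κ + 1) / (κ - 1) := by
    have h1 : 1 + θ / 2 = (κ + 1) / 4 := by rw [hθ]; ring
    have h2 : P = 4 / (κ - 1) := by rw [hP, h2α, div_div_eq_mul_div]; ring
    rw [h1, h2, div_mul_div_comm, mul_comm 4 (κ - 1), mul_div_mul_right _ _ four_ne_zero]
  set c₀ : ℝ := 3 * (K.Cr : ℝ) ^ 2 + 1 with hc₀
  have hc₀0 : 0 < c₀ := by positivity
  refine ⟨c₀ ^ β * A' ^ P + 1, by positivity, fun ν hν w hw hdiv S₄ E₀ hS₄ hE₀ L => ?_⟩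
  have h2 : (2 : ℝ≥0∞) ≠ 0 := two_ne_zero
  have h2' : (2 : ℝ≥0∞) ≠ ∞ := ENNReal.ofNat_ne_top
  -- abbreviations
  set e := stdOrthonormalBasis ℝ (EuclideanSpace ℝ (Fin 3)) with he
  set I : Finset ℤ := Finset.Icc (-(L : ℤ)) L with hI
  set a : ℤ → ℝ≥0∞ := blockL2 w with ha
  set σ : ℤ → ℝ≥0∞ := blockSup w with hσ
  set S : ℤ → ℝ := fun j => ∑ i, ∫ x, ‖fderiv ℝ (blockFn j w) x (e i)‖ ^ 2 with hS
  set N : ℤ → ℝ := fun j => ∫ x, ⟪blockFn j w x, blockFn j (convect w w) x⟫ with hN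
  set W : ℤ → ℝ≥0∞ := fun j => (2 : ℝ≥0∞) ^ (κ * (j : ℝ)) with hW
  set M : ℤ → ℝ≥0∞ := fun j => a j * ∑ m ∈ Finset.Icc (-2 : ℤ) 2, a (j + m) *
      paraT (fun l' => (2 : ℝ≥0∞) ^ l' * σ l') (j + m) + σ j * paraQ2 a (fun l => (2 : ℝ≥0∞) ^ l * a l) j with hM
  set y : ℝ≥0∞ := ∑' j : ℤ, W j * a j ^ 2 with hy
  set D : ℝ≥0∞ := ∑' j : ℤ, (2 : ℝ≥0∞) ^ ((κ + 2) * (j : ℝ)) * a j ^ 2 with hD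
  set D5 : ℝ≥0∞ := ∑' j : ℤ, (2 : ℝ≥0∞) ^ ((5 : ℝ) * (j : ℝ)) * a j ^ 2 with hD5
  set DL : ℝ≥0∞ := ∑ j ∈ I, (2 : ℝ≥0∞) ^ ((κ + 2) * (j : ℝ)) * a j ^ 2 with hDL
  set R : ℝ≥0∞ := (2⁻¹ : ℝ≥0∞) ^ L * (((K.Cr : ℝ≥0∞) ^ 4 * K.C₂ * S₄) ^ 2 + (K.C₂ * E₀) ^ 2) with hR
  set ε : ℝ := ν / c₀ with hε
  have hε0 : 0 < ε := div_pos hν hc₀0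
  -- finiteness
  have hytop : y ≠ ∞ := tsum_weighted_sq_ne_top' hw (by linarith) (by linarith)
  have hDtop : D ≠ ∞ := tsum_weighted_sq_ne_top' hw (by linarith) (by linarith)
  have hD5top : D5 ≠ ∞ := tsum_weighted_sq_ne_top' hw (by norm_num) (by norm_num)
  have hRtop : R ≠ ∞ := ENNReal.mul_ne_top (ENNReal.pow_ne_top (ENNReal.inv_ne_top.2 h2))
    (ENNReal.add_ne_top.2 ⟨ENNReal.pow_ne_top (ENNReal.mul_ne_top (ENNReal.mul_ne_top
      (ENNReal.pow_ne_top ENNReal.coe_ne_top) ENNReal.coe_ne_top) ENNReal.coe_ne_top),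
      ENNReal.pow_ne_top (ENNReal.mul_ne_top ENNReal.coe_ne_top ENNReal.coe_ne_top)⟩)
  have haj : ∀ j, a j ^ 2 ≠ ∞ := fun j => ENNReal.pow_ne_top ((hw.blockFn j).memLp_two).eLpNorm_ne_top
  have hWtop : ∀ j, W j ≠ ∞ := fun j => RiccatiSlice.two_rpow_ne_top _
  have hDLtop : DL ≠ ∞ := ENNReal.sum_ne_top.2 fun j _ =>
    ENNReal.mul_ne_top (RiccatiSlice.two_rpow_ne_top _) (haj j)
  have hDle : D ≤ DL + R := tsum_weighted_sq_le_window_add' hw (by exact_mod_cast hS₄) (by exact_mod_cast hE₀)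
    (by linarith) (by linarith) L
  have hS0 : ∀ j, 0 ≤ S j := fun j => Finset.sum_nonneg fun i _ => integral_nonneg fun x => by positivity
  -- (i) the viscous part: `ε · D_L ≤ ν ∑ W_j S_j`
  have hdiss : ∀ j : ℤ, ((2 : ℝ≥0∞) ^ ((κ + 2) * (j : ℝ)) * a j ^ 2).toReal ≤ c₀ * ((W j).toReal * S j) := by
    intro j
    have h4 := four_pow_mul_toReal_blockL2_sq_le hw j
    have hsplit : (2 : ℝ≥0∞) ^ ((κ + 2) * (j : ℝ)) = W j * (2 : ℝ≥0∞) ^ ((2 : ℝ) * (j : ℝ)) := by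
      rw [hW, ← ENNReal.rpow_add _ _ h2 h2']
      congr 1; ring
    rw [hsplit, ENNReal.toReal_mul, ENNReal.toReal_mul, toReal_two_rpow_two_mul]
    have hW0 : 0 ≤ (W j).toReal := ENNReal.toReal_nonneg
    calc (W j).toReal * (4 : ℝ) ^ j * (a j ^ 2).toReal = (W j).toReal * ((4 : ℝ) ^ j * (blockL2 w j ^ 2).toReal) := by
          rw [ha]; ring
      _ ≤ (W j).toReal * (3 * (K.Cr : ℝ) ^ 2 * S j) := mul_le_mul_of_nonneg_left h4 hW0
      _ ≤ (W j).toReal * (c₀ * S j) := by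
          refine mul_le_mul_of_nonneg_left ?_ hW0
          have e : c₀ * S j = 3 * (K.Cr : ℝ) ^ 2 * S j + S j := by rw [hc₀]; ring
          rw [e]; linarith [hS0 j]
      _ = c₀ * ((W j).toReal * S j) := by ring
  have hvisc : ε * DL.toReal ≤ ν * ∑ j ∈ I, (W j).toReal * S j := by
    have h1 : DL.toReal ≤ c₀ * ∑ j ∈ I, (W j).toReal * S j := by
      rw [hDL, ENNReal.toReal_sum fun j _ => ENNReal.mul_ne_top (RiccatiSlice.two_rpow_ne_top _) (haj j),
        Finset.mul_sum]
      exact Finset.sum_le_sum fun j _ => hdiss j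
    calc ε * DL.toReal ≤ ε * (c₀ * ∑ j ∈ I, (W j).toReal * S j) := mul_le_mul_of_nonneg_left h1 hε0.le
      _ = ν * ∑ j ∈ I, (W j).toReal * S j := by rw [hε]; field_simp
  -- (ii) the nonlinear part
  have hB' : ∀ l : ℤ, σ l ≤ CB * (2 : ℝ≥0∞) ^ ((3 / 2 : ℝ) * (l : ℝ)) * a l := fun l => by
    rw [show (3 / 2 : ℝ) * (l : ℝ) = 3 * (l : ℝ) / 2 by ring]
    exact hB w hw.memLp_two l
  have hricw := hric a σ CB hB'
  set Φ : ℝ≥0∞ := A * C * CB * y * D5 ^ (1 / 2 : ℝ) with hΦ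
  have hΦtop : Φ ≠ ∞ := ENNReal.mul_ne_top (ENNReal.mul_ne_top (ENNReal.mul_ne_top
    (ENNReal.mul_ne_top hAtop hCtop) ENNReal.coe_ne_top) hytop) (ENNReal.rpow_ne_top_of_nonneg (by norm_num) hD5top)
  have hnl_enn : ∑ j ∈ I, W j * ‖N j‖ₑ ≤ Φ := by
    calc ∑ j ∈ I, W j * ‖N j‖ₑ ≤ ∑ j ∈ I, W j * (A * M j) := Finset.sum_le_sum fun j _ => by
          gcongr; exact hA w hw hdiv j
      _ = A * ∑ j ∈ I, W j * M j := by rw [Finset.mul_sum]; exact Finset.sum_congr rfl fun j _ => by ring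
      _ ≤ A * ∑' j : ℤ, W j * M j := by gcongr; exact ENNReal.sum_le_tsum I
      _ ≤ A * (C * CB * y * D5 ^ (1 / 2 : ℝ)) := by gcongr
      _ = Φ := by rw [hΦ]; ring
  have hnl : ∑ j ∈ I, (W j).toReal * (-N j) ≤ A' * y.toReal * D5.toReal ^ (1 / 2 : ℝ) := by
    have hΦr : Φ.toReal = A' * y.toReal * D5.toReal ^ (1 / 2 : ℝ) := by
      rw [hΦ, hA', ENNReal.toReal_mul, ENNReal.toReal_mul, ENNReal.toReal_rpow]
    calc ∑ j ∈ I, (W j).toReal * (-N j) ≤ ∑ j ∈ I, (W j * ‖N j‖ₑ).toReal := by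
          refine Finset.sum_le_sum fun j _ => ?_
          rw [ENNReal.toReal_mul, Real.enorm_eq_ofReal_abs, ENNReal.toReal_ofReal (abs_nonneg _)]
          exact mul_le_mul_of_nonneg_left (neg_le_abs _) ENNReal.toReal_nonneg
      _ = (∑ j ∈ I, W j * ‖N j‖ₑ).toReal :=
          (ENNReal.toReal_sum fun j _ => ENNReal.mul_ne_top (hWtop j) enorm_ne_top).symm
      _ ≤ Φ.toReal := ENNReal.toReal_mono hΦtop hnl_enn
      _ = A' * y.toReal * D5.toReal ^ (1 / 2 : ℝ) := hΦr
  -- (iii) Hölder over the levels: `D5 ≤ y^θ D^α`, in real form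
  have hD0 : 0 ≤ D.toReal := ENNReal.toReal_nonneg
  have hy0 : 0 ≤ y.toReal := ENNReal.toReal_nonneg
  have hA'0 : 0 ≤ A' := ENNReal.toReal_nonneg
  have hholder : D5.toReal ^ (1 / 2 : ℝ) ≤ y.toReal ^ (θ / 2) * D.toReal ^ (α / 2) := by
    have h1 : D5 ≤ y ^ θ * D ^ α := tsum_five_le_rpow_mul_rpow hκ3 hκ5 a
    have h2 : D5.toReal ≤ y.toReal ^ θ * D.toReal ^ α := by
      have := ENNReal.toReal_mono (ENNReal.mul_ne_top (ENNReal.rpow_ne_top_of_nonneg hθ0.le hytop)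
        (ENNReal.rpow_ne_top_of_nonneg hα0.le hDtop)) h1
      rwa [ENNReal.toReal_mul, ← ENNReal.toReal_rpow, ← ENNReal.toReal_rpow] at this
    calc D5.toReal ^ (1 / 2 : ℝ) ≤ (y.toReal ^ θ * D.toReal ^ α) ^ (1 / 2 : ℝ) :=
          Real.rpow_le_rpow ENNReal.toReal_nonneg h2 (by norm_num)
      _ = y.toReal ^ (θ / 2) * D.toReal ^ (α / 2) := by
          rw [Real.mul_rpow (Real.rpow_nonneg hy0 _) (Real.rpow_nonneg hD0 _), ← Real.rpow_mul hy0,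
            ← Real.rpow_mul hD0]
          congr 2 <;> ring
  -- (iv) Young
  set U : ℝ := A' * y.toReal ^ (1 + θ / 2) with hU
  have hU0 : 0 ≤ U := mul_nonneg hA'0 (Real.rpow_nonneg hy0 _)
  have hnl2 : A' * y.toReal * D5.toReal ^ (1 / 2 : ℝ) ≤ U * D.toReal ^ (α / 2) := by
    have e1 : y.toReal ^ (1 + θ / 2) = y.toReal * y.toReal ^ (θ / 2) := by
      rw [Real.rpow_add' hy0 (by linarith), Real.rpow_one]
    calc A' * y.toReal * D5.toReal ^ (1 / 2 : ℝ) ≤ A' * y.toReal * (y.toReal ^ (θ / 2) * D.toReal ^ (α / 2)) :=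
          mul_le_mul_of_nonneg_left hholder (mul_nonneg hA'0 hy0)
      _ = U * D.toReal ^ (α / 2) := by rw [hU, e1]; ring
  have hyoung : U * D.toReal ^ (α / 2) ≤ ε * D.toReal + ε ^ (-(α / (2 - α))) * U ^ (2 / (2 - α)) :=
    young_rpow hU0 hD0 hε0 hα0 hα2
  have hUP : ε ^ (-(α / (2 - α))) * U ^ (2 / (2 - α)) =
      c₀ ^ β * A' ^ P * ν ^ (-β) * y.toReal ^ ((κ + 1) / (κ - 1)) := by
    rw [hβe, ← hP, hU, Real.mul_rpow hA'0 (Real.rpow_nonneg hy0 _), ← Real.rpow_mul hy0, hpe, hε,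
      Real.div_rpow hν.le hc₀0.le, Real.rpow_neg hc₀0.le, div_inv_eq_mul]
    ring
  have htail : D.toReal ≤ DL.toReal + R.toReal := by
    rw [← ENNReal.toReal_add hDLtop hRtop]
    exact ENNReal.toReal_mono (ENNReal.add_ne_top.2 ⟨hDLtop, hRtop⟩) hDle
  -- assemble
  have hsplit : ∑ j ∈ I, (W j).toReal * (-ν * S j - N j) =
      -(ν * ∑ j ∈ I, (W j).toReal * S j) + ∑ j ∈ I, (W j).toReal * (-N j) := by
    rw [Finset.mul_sum, ← Finset.sum_neg_distrib, ← Finset.sum_add_distrib]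
    exact Finset.sum_congr rfl fun j _ => by ring
  have hK₁ : c₀ ^ β * A' ^ P * ν ^ (-β) * y.toReal ^ ((κ + 1) / (κ - 1)) ≤
      (c₀ ^ β * A' ^ P + 1) * ν ^ (-β) * y.toReal ^ ((κ + 1) / (κ - 1)) := by
    have h1 : 0 ≤ ν ^ (-β) * y.toReal ^ ((κ + 1) / (κ - 1)) :=
      mul_nonneg (Real.rpow_nonneg hν.le _) (Real.rpow_nonneg hy0 _)
    have e : (c₀ ^ β * A' ^ P + 1) * ν ^ (-β) * y.toReal ^ ((κ + 1) / (κ - 1)) =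
        c₀ ^ β * A' ^ P * ν ^ (-β) * y.toReal ^ ((κ + 1) / (κ - 1)) + ν ^ (-β) * y.toReal ^ ((κ + 1) / (κ - 1)) := by
      ring
    rw [e]; linarith
  have htail' : ε * D.toReal ≤ ε * DL.toReal + ε * R.toReal := by
    have h := mul_le_mul_of_nonneg_left htail hε0.le
    rwa [mul_add] at h
  set T : ℝ := ε ^ (-(α / (2 - α))) * U ^ (2 / (2 - α)) with hT
  calc ∑ j ∈ I, (W j).toReal * (-ν * S j - N j)
      = -(ν * ∑ j ∈ I, (W j).toReal * S j) + ∑ j ∈ I, (W j).toReal * (-N j) := hsplit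
    _ ≤ -(ε * DL.toReal) + U * D.toReal ^ (α / 2) := add_le_add (neg_le_neg hvisc) (hnl.trans hnl2)
    _ ≤ -(ε * DL.toReal) + (ε * D.toReal + T) := by linarith [hyoung]
    _ ≤ ε * R.toReal + T := by linarith [htail']
    _ = ε * R.toReal + c₀ ^ β * A' ^ P * ν ^ (-β) * y.toReal ^ ((κ + 1) / (κ - 1)) := by rw [hUP]
    _ ≤ ε * R.toReal + (c₀ ^ β * A' ^ P + 1) * ν ^ (-β) * y.toReal ^ ((κ + 1) / (κ - 1)) := by linarith [hK₁]

end Summit.NavierStokesRegularity.FluidComputer.RiccatiSliceGen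

end
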